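import Mathlib
import Summits.Ventures.PercRepro.TriangleCapDeltaForm
import Summits.Ventures.PercRepro.TriangleCapW29Matroid

/-!
# PercRepro — the kernel negative record of ROW C-046: `¬ ExistsDeltaCocircuit (Fin 29)` (p3, gen 27; part 2 of 2)

On the matroid `W29.M` of TriangleCapW29Matroid (the 29-point binary core of mine-4 g27's kill witness
`W31`, RULING (um)(96), 2026-08-26):

* `core3 : Core3 M` — simple (`pair_indep`), (C1) lines `≤ 3` and (C2) planes `≤ 6` through the basis of
  the flat (`exists_subset_cl`, `c1cert` / `c2cert`), (C3) rank-`4` flats `≤ 10` through two independent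
  functionals vanishing on the flat (`Subspace.finrank_add_finrank_dualAnnihilator_eq`, `c3cert`);
* `eRank_eq : M.eRank = 6`, `encard_eq : M.E.encard = M.eRank + 23` (nullity `23`, `P_KK(23) = 59`);
* `mem_triangles_iff` — the triangles of `M` are exactly the `3`-sets of zero xor (`tri`, `60` of them:
  `T(M) = 60 > 59`), `gain_eq` (`gain M (coc n) = gainN n`);
* `cocircuit_eq` — every cocircuit is the support `coc n` of a nonzero functional `n : Fin 64` (the
  complement of a cocircuit spans a hyperplane `ker f`, `eRk_compl_add_one_eq_eRank`);
* **`not_existsDeltaCocircuit : ¬ ExistsDeltaCocircuit (Fin 29)`** — from `cert`: no cocircuit of `W29`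
  has gain `≤ P 23 − P (23 − (|K| − 1))`.  Hence the chain of record
  `T ≤ P_KK(ν) ⟸ ExistsDeltaCocircuitCore ⟸ …Insep ⟸ ExistsDeltaCocircuit` has a false bottom on
  `Fin 29` (the tree's negative record asked for in (um)(96)).

Axioms: standard.
-/

open scoped Matroid

namespace PercRepro

namespace TriangleCap

namespace W29

open Set Matroid Module Submodule

/-- Two distinct points are independent (distinct nonzero vectors over `GF(2)`). -/
theorem pair_indep {a b : Fin 29} (hab : a ≠ b) : M.Indep {a, b} := by
  have hab' : a ∉ ({b} : Set (Fin 29)) := by simpa using hab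
  rw [indep_iff, linearIndepOn_insert hab']
  refine ⟨LinearIndepOn.singleton (v_ne_zero b), ?_⟩
  rw [image_singleton, mem_span_singleton]
  rintro ⟨c, hc⟩
  rcases zmod2_cases c with rfl | rfl
  · rw [zero_smul] at hc
    exact v_ne_zero a hc.symm
  · rw [one_smul] at hc
    exact hab (v_inj a b hc.symm)

/-- `M` is simple. -/
theorem core3_simple : ∀ e ∈ M.E, ∀ f ∈ M.E, e ≠ f → M.eRk {e, f} = 2 := by
  intro e _ f _ hef
  rw [(pair_indep hef).eRk_eq_encard, encard_pair hef]

/-- A vector in the span of the points of `I` is a sum over a subset of `I` (`GF(2)` coefficients). -/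
theorem mem_span_imp_exists_xsum {I : Finset (Fin 29)} {x : V}
    (hx : x ∈ span (ZMod 2) (v '' (I : Set (Fin 29)))) : ∃ J ⊆ I, x = ∑ i ∈ J, v i := by
  rw [← Finset.coe_image, mem_span_finset] at hx
  obtain ⟨c, -, hc⟩ := hx
  rw [Finset.sum_image (fun a _ b _ h => v_injective h)] at hc
  refine ⟨I.filter (fun i => c (v i) = 1), Finset.filter_subset _ _, ?_⟩
  rw [Finset.sum_filter, ← hc]
  refine Finset.sum_congr rfl (fun i _ => ?_)
  rcases zmod2_cases (c (v i)) with h | h <;> simp [h]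

/-- A point in the span of `I` lies in `cl I`. -/
theorem mem_cl_of_mem_span {I : Finset (Fin 29)} {x : Fin 29}
    (hx : v x ∈ span (ZMod 2) (v '' (I : Set (Fin 29)))) : x ∈ cl I := by
  obtain ⟨J, hJI, hJ⟩ := mem_span_imp_exists_xsum hx
  rw [cl, Finset.mem_filter]
  refine ⟨Finset.mem_univ _, ?_⟩
  rw [spanCodes, Finset.mem_image]
  refine ⟨J, Finset.mem_powerset.2 hJI, ?_⟩
  have h1 : vec (xsum J) = vec (code x) := by rw [vec_xsum, ← hJ]; rfl
  exact vec_inj_of_lt (xsum_lt J) (code_lt x) h1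

/-- `cl` is monotone. -/
theorem cl_mono {I I' : Finset (Fin 29)} (h : I ⊆ I') : cl I ⊆ cl I' := by
  intro x hx
  simp only [cl, spanCodes, Finset.mem_filter, Finset.mem_univ, true_and, Finset.mem_image,
    Finset.mem_powerset] at hx ⊢
  obtain ⟨J, hJ, hJx⟩ := hx
  exact ⟨J, hJ.trans h, hJx⟩

/-- A set of rank `≤ k ≤ 29` lies in the closure of a `k`-set. -/
theorem exists_subset_cl {X : Set (Fin 29)} {k : ℕ} (hk : k ≤ 29) (hX : M.eRk X ≤ k) :
    ∃ I : Finset (Fin 29), I.card = k ∧ X ⊆ ↑(cl I) := by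
  obtain ⟨I, hI⟩ := M.exists_isBasis' X
  have hIfin : I.Finite := toFinite I
  have hIcard : hIfin.toFinset.card ≤ k := by
    rw [hI.eRk_eq_encard, ← hIfin.cast_ncard_eq, ncard_eq_toFinset_card I hIfin] at hX
    exact_mod_cast hX
  obtain ⟨I', hII', -, hI'card⟩ :=
    Finset.exists_subsuperset_card_eq (Finset.subset_univ hIfin.toFinset) hIcard (by simpa using hk)
  refine ⟨I', hI'card, fun x hx => ?_⟩
  apply cl_mono hII'
  apply mem_cl_of_mem_span
  rw [hIfin.coe_toFinset]
  have : v x ∈ span (ZMod 2) (v '' X) := subset_span (mem_image_of_mem v hx)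
  rwa [span_image_eq_of_isBasis' hI] at this

/-- (C1) from the certificate: the span of `2` points holds `≤ 3` points. -/
theorem cl_card_le_of_card_two {I : Finset (Fin 29)} (hI : I.card = 2) : (cl I).card ≤ 3 := by
  have h := c1cert
  rw [Finset.card_eq_zero, Finset.filter_eq_empty_iff] at h
  exact not_lt.1 (h (Finset.mem_powersetCard_univ.2 hI))

/-- (C2) from the certificate: the span of `3` points holds `≤ 6` points. -/
theorem cl_card_le_of_card_three {I : Finset (Fin 29)} (hI : I.card = 3) : (cl I).card ≤ 6 := by
  have h := c2cert
  rw [Finset.card_eq_zero, Finset.filter_eq_empty_iff] at h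
  exact not_lt.1 (h (Finset.mem_powersetCard_univ.2 hI))

/-- (C1): lines have at most `3` points. -/
theorem core3_c1 : ∀ L ⊆ M.E, M.eRk L = 2 → L.ncard ≤ 3 := by
  intro L _ hL
  obtain ⟨I, hI, hLI⟩ := exists_subset_cl (k := 2) (by norm_num) hL.le
  calc L.ncard ≤ ((cl I : Finset (Fin 29)) : Set (Fin 29)).ncard := ncard_le_ncard hLI
    _ = (cl I).card := ncard_coe_finset _
    _ ≤ 3 := cl_card_le_of_card_two hI

/-- (C2): planes have at most `6` points. -/
theorem core3_c2 : ∀ P ⊆ M.E, M.eRk P ≤ 3 → P.ncard ≤ 6 := by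
  intro P _ hP
  obtain ⟨I, hI, hPI⟩ := exists_subset_cl (k := 3) (by norm_num) hP
  calc P.ncard ≤ ((cl I : Finset (Fin 29)) : Set (Fin 29)).ncard := ncard_le_ncard hPI
    _ = (cl I).card := ncard_coe_finset _
    _ ≤ 6 := cl_card_le_of_card_three hI

/-- (C3): rank-`4` flats have at most `10` points (two independent functionals vanish on the flat). -/
theorem core3_c3 : ∀ X ⊆ M.E, M.eRk X ≤ 4 → X.ncard ≤ 10 := by
  intro X _ hX
  set U := span (ZMod 2) (v '' X) with hU
  have hfin : finrank (ZMod 2) U ≤ 4 := by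
    rw [eRk_eq] at hX
    exact_mod_cast hX
  have hann : 2 ≤ finrank (ZMod 2) U.dualAnnihilator := by
    have := Subspace.finrank_add_finrank_dualAnnihilator_eq U
    rw [Module.finrank_fin_fun] at this
    omega
  have hne : U.dualAnnihilator ≠ ⊥ := by
    intro h
    rw [h, finrank_bot] at hann
    omega
  obtain ⟨f, hf, hf0⟩ := Submodule.exists_mem_ne_zero_of_ne_bot hne
  have hlt : span (ZMod 2) {f} < U.dualAnnihilator := by
    apply Submodule.lt_of_le_of_finrank_lt_finrank
    · rw [span_le, singleton_subset_iff]
      exact hf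
    · rw [finrank_span_singleton hf0]
      omega
  obtain ⟨g, hg, hgf⟩ := SetLike.exists_of_lt hlt
  have hg0 : g ≠ 0 := fun h => hgf (h ▸ zero_mem _)
  have hgf' : g ≠ f := by
    intro h
    apply hgf
    rw [h]
    exact mem_span_singleton_self f
  obtain ⟨n, hn⟩ := exists_vec_eq (wt f)
  obtain ⟨m, hm⟩ := exists_vec_eq (wt g)
  have hn0 : n.val ≠ 0 := fin64_ne_zero_of_vec hn (fun h => hf0 (eq_zero_of_wt_eq_zero h))
  have hm0 : m.val ≠ 0 := fin64_ne_zero_of_vec hm (fun h => hg0 (eq_zero_of_wt_eq_zero h))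
  have hnm : n ≠ m := by
    intro h
    apply hgf'
    apply wt_injective
    rw [← hm, ← hn, h]
  have hsub : X ⊆ ↑(cut n.val m.val) := by
    intro x hx
    have hxU : v x ∈ U := subset_span (mem_image_of_mem v hx)
    have hfx : f (v x) = 0 := (mem_dualAnnihilator f).1 hf _ hxU
    have hgx : g (v x) = 0 := (mem_dualAnnihilator g).1 hg _ hxU
    rw [apply_eq_dot, ← hn] at hfx
    rw [apply_eq_dot, ← hm] at hgx
    simp only [cut, Finset.coe_filter, mem_setOf_eq, Finset.mem_univ, true_and]
    exact ⟨(dot_vec_eq_zero_iff n x).1 hfx, (dot_vec_eq_zero_iff m x).1 hgx⟩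
  calc X.ncard ≤ ((cut n.val m.val : Finset (Fin 29)) : Set (Fin 29)).ncard := ncard_le_ncard hsub
    _ = (cut n.val m.val).card := ncard_coe_finset _
    _ ≤ 10 := c3cert n m hn0 hm0 hnm

/-- `W29` is in the class of the closed form. -/
theorem core3 : Cocirc.Core3 M where
  simple := core3_simple
  c1 := core3_c1
  c2 := core3_c2
  c3 := core3_c3

/-- The unit vectors lie in the span of the points. -/
theorem unit_mem_span (i : Fin 6) :
    (fun j => if i = j then (1 : ZMod 2) else 0) ∈ span (ZMod 2) (v '' univ) := by
  have hv : ∀ a : Fin 29, v a ∈ span (ZMod 2) (v '' univ) :=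
    fun a => subset_span (mem_image_of_mem v (mem_univ a))
  rw [unit_eq i, vec_xsum]
  exact sum_mem (fun a _ => hv a)

/-- The points span `GF(2)^6`. -/
theorem span_univ_eq_top : span (ZMod 2) (v '' univ) = ⊤ := by
  rw [eq_top_iff]
  intro x _
  rw [pi_eq_sum_univ x]
  exact sum_mem (fun i _ => smul_mem _ _ (unit_mem_span i))

/-- `M` has rank `6`. -/
theorem eRank_eq : M.eRank = 6 := by
  rw [Matroid.eRank_def, ground_eq, eRk_eq, span_univ_eq_top, finrank_top, Module.finrank_fin_fun]
  rfl

/-- `|E| = r(M) + 23`: the nullity of `W29` is `23`. -/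
theorem encard_eq : M.E.encard = M.eRank + 23 := by
  rw [eRank_eq, ground_eq, encard_univ, ENat.card_eq_coe_fintype_card, Fintype.card_fin]
  rfl

/-- Three distinct points with zero sum are dependent. -/
theorem triangle_dep {a b c : Fin 29} (hab : a ≠ b) (hac : a ≠ c)
    (h : v a + v b + v c = 0) : ¬ M.Indep {a, b, c} := by
  have ha : a ∉ ({b, c} : Set (Fin 29)) := by simp [hab, hac]
  rw [indep_iff, linearIndepOn_insert ha]
  rintro ⟨-, hspan⟩
  apply hspan
  have hva : v a = v b + v c := by
    calc v a = v a + (v b + v c) + (v b + v c) := by rw [add_assoc, add_self_eq_zero, add_zero]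
      _ = (v a + v b + v c) + (v b + v c) := by abel
      _ = v b + v c := by rw [h, zero_add]
  rw [hva, image_pair]
  exact add_mem (subset_span (mem_insert _ _)) (subset_span (mem_insert_of_mem _ (mem_singleton _)))

/-- Three distinct dependent points have zero sum. -/
theorem triangle_indep_of_dep {a b c : Fin 29} (hab : a ≠ b) (hac : a ≠ c) (hbc : b ≠ c)
    (h : ¬ M.Indep {a, b, c}) : v a + v b + v c = 0 := by
  have ha : a ∉ ({b, c} : Set (Fin 29)) := by simp [hab, hac]
  rw [indep_iff, linearIndepOn_insert ha, not_and, not_not] at h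
  have hspan := h (indep_iff.1 (pair_indep hbc))
  rw [image_pair, mem_span_pair] at hspan
  obtain ⟨x, y, hxy⟩ := hspan
  rcases zmod2_cases x with rfl | rfl <;> rcases zmod2_cases y with rfl | rfl
  · rw [zero_smul, zero_smul, add_zero] at hxy
    exact absurd hxy.symm (v_ne_zero a)
  · rw [zero_smul, one_smul, zero_add] at hxy
    exact absurd (v_inj _ _ hxy) hac.symm
  · rw [one_smul, zero_smul, add_zero] at hxy
    exact absurd (v_inj _ _ hxy) hab.symm
  · rw [one_smul, one_smul] at hxy
    rw [← hxy, add_assoc, add_self_eq_zero]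

/-- The triangles of `M` are exactly the coerced members of `tri`. -/
theorem mem_triangles_iff {C : Set (Fin 29)} : C ∈ ThmN.triangles M ↔ ∃ t ∈ tri, C = ↑t := by
  constructor
  · rintro ⟨hC, hC3⟩
    obtain ⟨a, b, c, hab, hac, hbc, rfl⟩ := ncard_eq_three.1 hC3
    have hdep : ¬ M.Indep {a, b, c} := hC.dep.not_indep
    have hsum := triangle_indep_of_dep hab hac hbc hdep
    refine ⟨{a, b, c}, ?_, by simp⟩
    rw [tri, Finset.mem_filter, Finset.mem_powersetCard_univ]
    refine ⟨Finset.card_eq_three.2 ⟨a, b, c, hab, hac, hbc, rfl⟩, ?_⟩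
    have h1 : vec (xsum {a, b, c}) = vec 0 := by
      rw [vec_xsum, vec_zero, Finset.sum_insert (by simp [hab, hac]),
        Finset.sum_insert (by simpa using hbc), Finset.sum_singleton, ← add_assoc, hsum]
    exact vec_inj_of_lt (xsum_lt _) (by norm_num) h1
  · rintro ⟨t, ht, rfl⟩
    rw [tri, Finset.mem_filter, Finset.mem_powersetCard_univ] at ht
    obtain ⟨ht3, hts⟩ := ht
    obtain ⟨a, b, c, hab, hac, hbc, rfl⟩ := Finset.card_eq_three.1 ht3
    have hsum : v a + v b + v c = 0 := by
      have h1 := vec_xsum {a, b, c}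
      rw [hts, vec_zero, Finset.sum_insert (by simp [hab, hac]),
        Finset.sum_insert (by simpa using hbc), Finset.sum_singleton, ← add_assoc] at h1
      exact h1.symm
    refine ⟨?_, ?_⟩
    · rw [Matroid.isCircuit_iff_dep_forall_sdiff_singleton_indep]
      refine ⟨⟨?_, subset_univ _⟩, ?_⟩
      · push_cast
        exact triangle_dep hab hac hsum
      · intro e he
        have hcard : (((({a, b, c} : Finset (Fin 29)) : Set (Fin 29))) \ {e}).ncard = 2 := by
          rw [ncard_sdiff_singleton_of_mem he, ncard_coe_finset, ht3]
        obtain ⟨x, y, hxy, hxy'⟩ := ncard_eq_two.1 hcard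
        rw [hxy']
        exact pair_indep hxy
    · rw [ncard_coe_finset, ht3]

/-- `M` has a triangle. -/
theorem triangles_nonempty : (ThmN.triangles M).Nonempty :=
  ⟨↑({0, 1, 2} : Finset (Fin 29)), mem_triangles_iff.2 ⟨_, tri_nonempty, rfl⟩⟩

/-- The triangles of `M` as the image of the finset `tri`. -/
theorem triangles_eq : ThmN.triangles M = (fun t : Finset (Fin 29) => (t : Set (Fin 29))) '' ↑tri := by
  ext C
  rw [mem_triangles_iff, mem_image]
  constructor <;> rintro ⟨t, ht, rfl⟩ <;> exact ⟨t, ht, rfl⟩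

/-- The gain of the support of `n` is the certificate's count. -/
theorem gain_eq (n : ℕ) : Cocirc.gain M ↑(coc n) = gainN n := by
  unfold Cocirc.gain gainN
  have hset : {C ∈ ThmN.triangles M | ¬ C ⊆ M.E \ ↑(coc n)} =
      (fun t : Finset (Fin 29) => (t : Set (Fin 29))) '' ↑(tri.filter (fun t => ∃ i ∈ t, i ∈ coc n)) := by
    ext C
    simp only [mem_setOf_eq, triangles_eq, mem_image, Finset.coe_filter, ground_eq]
    constructor
    · rintro ⟨⟨t, ht, rfl⟩, hC⟩
      refine ⟨t, ⟨ht, ?_⟩, rfl⟩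
      rw [not_subset] at hC
      obtain ⟨x, hxt, hx⟩ := hC
      refine ⟨x, Finset.mem_coe.1 hxt, ?_⟩
      simpa using hx
    · rintro ⟨t, ⟨ht, x, hxt, hx⟩, rfl⟩
      refine ⟨⟨t, ht, rfl⟩, ?_⟩
      rw [not_subset]
      exact ⟨x, Finset.mem_coe.2 hxt, by simpa using hx⟩
  rw [hset, ncard_image_of_injective _ Finset.coe_injective, ncard_coe_finset]

/-- Every cocircuit of `M` is the support of a nonzero functional. -/
theorem cocircuit_eq {K : Set (Fin 29)} (hK : M.IsCocircuit K) :
    ∃ n : Fin 64, n.val ≠ 0 ∧ K = ↑(coc n.val) := by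
  haveI := M_finite
  have hrk := Cocirc.eRk_compl_add_one_eq_eRank M hK
  rw [eRank_eq, eRk_eq] at hrk
  set U := span (ZMod 2) (v '' (M.E \ K)) with hU
  have hH5 : finrank (ZMod 2) U = 5 := by
    have h6 : ((finrank (ZMod 2) U + 1 : ℕ) : ℕ∞) = ((6 : ℕ) : ℕ∞) := by
      push_cast
      exact hrk
    have := Nat.cast_inj.1 h6
    omega
  have hUlt : U < ⊤ :=
    Submodule.lt_top_of_finrank_lt_finrank (by rw [hH5, Module.finrank_fin_fun]; norm_num)
  obtain ⟨f, hf0, hfU⟩ := Submodule.exists_dual_map_eq_bot_of_lt_top hUlt inferInstance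
  have hfU' : ∀ u ∈ U, f u = 0 := by
    intro u hu
    have : f u ∈ U.map f := mem_map_of_mem hu
    rw [hfU] at this
    exact (mem_bot _).1 this
  have hker : U = LinearMap.ker f := by
    apply Submodule.eq_of_le_of_finrank_eq
    · intro u hu
      exact LinearMap.mem_ker.2 (hfU' u hu)
    · rw [hH5]
      have h1 := LinearMap.finrank_range_add_finrank_ker f
      rw [Module.finrank_fin_fun] at h1
      have hr : finrank (ZMod 2) (LinearMap.range f) = 1 := by
        apply le_antisymm
        · calc finrank (ZMod 2) (LinearMap.range f) ≤ finrank (ZMod 2) (ZMod 2) :=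
              Submodule.finrank_le _
            _ = 1 := Module.finrank_self _
        · have hne : LinearMap.range f ≠ ⊥ := by rwa [Ne, LinearMap.range_eq_bot]
          exact Nat.pos_of_ne_zero (mt Submodule.finrank_eq_zero.1 hne)
      omega
  have hKout : ∀ x ∈ K, v x ∉ U := by
    intro x hxK hxU
    have hmin := Matroid.isCocircuit_iff_minimal_compl_nonspanning.1 hK
    have hsp : M.Spanning (M.E \ (K \ {x})) := by
      by_contra h
      have hle : K ⊆ K \ {x} := hmin.2 h sdiff_subset
      exact (hle hxK).2 (mem_singleton x)
    have hset : M.E \ (K \ {x}) = insert x (M.E \ K) := by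
      ext y
      simp only [mem_sdiff, mem_singleton_iff, mem_insert_iff, not_and, not_not]
      constructor
      · rintro ⟨hyE, hy⟩
        by_cases hyK : y ∈ K
        · exact Or.inl (hy hyK)
        · exact Or.inr ⟨hyE, hyK⟩
      · rintro (rfl | ⟨hyE, hyK⟩)
        · exact ⟨hK.subset_ground hxK, fun _ => rfl⟩
        · exact ⟨hyE, fun h => absurd h hyK⟩
    rw [hset] at hsp
    have h6 : M.eRk (insert x (M.E \ K)) = 6 := by rw [hsp.eRk_eq, eRank_eq]
    rw [eRk_eq, image_insert_eq, span_insert_eq_span hxU, ← hU, hH5] at h6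
    exact absurd h6 (by decide)
  have hHin : ∀ x ∉ K, v x ∈ U := fun x hx =>
    subset_span (mem_image_of_mem v ⟨mem_univ x, hx⟩)
  obtain ⟨n, hn⟩ := exists_vec_eq (wt f)
  have hn0 : n.val ≠ 0 := fin64_ne_zero_of_vec hn (fun h => hf0 (eq_zero_of_wt_eq_zero h))
  refine ⟨n, hn0, ?_⟩
  ext x
  simp only [coc, Finset.coe_filter, Finset.mem_univ, true_and, mem_setOf_eq]
  rw [← dot_vec_ne_zero_iff n x, hn, ← apply_eq_dot]
  constructor
  · intro hxK hfx
    exact hKout x hxK (hker ▸ LinearMap.mem_ker.2 hfx)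
  · intro hfx
    by_contra hxK
    exact hfx (hfU' _ (hHin x hxK))

/-- **ROW C-046 is false**: on `W29` every cocircuit has gain above the Δ bound. -/
theorem not_existsDeltaCocircuit : ¬ Cocirc.ExistsDeltaCocircuit (Fin 29) := by
  intro h
  haveI := M_finite
  obtain ⟨K, hK, hg⟩ := h M core3 triangles_nonempty 23 encard_eq
  obtain ⟨n, hn0, rfl⟩ := cocircuit_eq hK
  rw [gain_eq, ncard_coe_finset] at hg
  exact absurd hg (not_le.2 (cert n hn0))

end W29

end TriangleCap

end PercRepro
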